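import Literature.NumberTheory.EllipticCurves.IwasawaAlgebraSpecializationLambdaTransferProofs
import HarnessLib

/-!
# Translated `λ`-primes `𝔮_c = (f(T − c))` of `Λ = ℤ_p⟦T⟧`: the coefficient ring `Λ ⧸ 𝔮_c ≅ Λ ⧸ (f)`
# is independent of `c`; specialised-index counts at `𝔮_m = (f(T − p^m))` (proofs file)

Topic `NumberTheory/EllipticCurves`. THEOREMS ONLY (no definition, no named fact, no `sorry`). A variant of
Howard's specialisation device ([Howard 2004] proof of Thm. 2.2.10 = [Mazur–Rubin 2004] §5.3, proof of
Thm. 5.3.10: «fix a height-one prime `𝔓 = (f) ≠ pΛ`, specialise at `𝔔 = (f + p^m)`, `m → ∞`; by Hensel's lemma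
`Λ/𝔔 ≅ Λ/𝔓` for `m ≫ 0`») in which the perturbed primes `(f + p^m)` of the sibling files
`IwasawaAlgebraSpecializationLambda{,Transfer}Proofs` are replaced by the TRANSLATED primes `𝔮_m = (f(T − p^m))`.
Point of the variant: `Λ ⧸ (f(T − c)) ≃ₐ[ℤ_p] Λ ⧸ (f)`, `T̄ ↦ T̄ + c`, for EVERY `c ∈ pℤ_p`, with no Hensel/Krasner
argument (Weierstrass division identifies both sides with `ℤ_p[T]/(·)`; `T ↦ T + c` is an automorphism of
`ℤ_p[T]`) — so the coefficient ring of the specialisation, with its normalisation, index and residue field,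
is literally the same for all `m`. The price is to redo the module-theoretic counts, which is this file: modulo
`f`, `g(T + p^m) ≡ g + p^m r` and `f(T + p^m) ≡ p^m (f′ + p^m k)`, whence `#((Λ/(gⁿ)) ⧸ 𝔮_m) = c·p^{m·deg f·e}`
for `m ≫ 0` (`e = n` iff `f ∣ g`) — the shape the `λ`-transfer consumes. HONEST FRAMING: pure `Λ`-algebra; the
arithmetic (specialised Kolyvagin-system bounds) is not here; BSD is not proved by any of this.
Contents: §1 `isDistinguishedAt_comp_X_sub_C`, `irreducible_comp_X_sub_C`, `prime_coe_comp_X_sub_C`,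
`algEquivQuotient_mk`; §2 **`exists_algEquiv_quotient_span_comp_X_sub_C`** (the ring isomorphism),
`card_quotient_span_comp_sup_span_coe` (`#Λ/(f(T − c), h) = #Λ/(f, h(T + c))`); §3 ideal lemmas
(`span_sup_span_add_mul_C_pow_eq_of_C_pow_mem`: `(q, h + p^m r) = (q, h)` once `p^{m₀} ∈ (q, h)`, `m > m₀`;
`not_coe_dvd_coe_of_natDegree_lt`; Taylor to first / second order); §4 (counts at `𝔮_m`)
**`exists_card_quotient_coe_pow_quotSMulTop_comp`** (cyclic piece), **`exists_card_elementaryModule_quotSMulTop_comp`**.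
References: [Howard2004HeegnerKolyvagin] proof of Thm. 2.2.10; [MazurRubin2004] §5.3 (proof of Thm. 5.3.10);
[Washington1997] §7.1 (Prop. 7.2), §13.2 (Lemma 13.7, Prop. 13.8, Thm. 13.12); [Lang1980] Ch. 5 §2.
-/

set_option autoImplicit false

noncomputable section

open scoped Classical Pointwise Polynomial DirectSum

namespace Literature.NumberTheory.EllipticCurves

namespace IwasawaAlgebra

variable (p : ℕ) [Fact p.Prime]

/-! ### §1 Translates `f(T − c)` of a distinguished polynomial -/

/-- `deg f(T − c) = deg f`. [cite: Washington1997, §7.1] -/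
theorem natDegree_comp_X_sub_C (f : ℤ_[p][X]) (c : ℤ_[p]) :
    (f.comp (Polynomial.X - Polynomial.C c)).natDegree = f.natDegree := by
  rw [Polynomial.natDegree_comp, Polynomial.natDegree_X_sub_C, mul_one]

/-- `p^m ∈ 𝔪_{ℤ_p}` for `m ≥ 1`. [cite: Washington1997, §7.1] -/
theorem pow_p_mem_maximalIdeal {m : ℕ} (hm : 1 ≤ m) : (p : ℤ_[p]) ^ m ∈ IsLocalRing.maximalIdeal ℤ_[p] := by
  rw [PadicInt.maximalIdeal_eq_span_p, Ideal.mem_span_singleton]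
  exact dvd_pow_self _ (by omega)

/-- **`f(T − c)` is distinguished** for `f` distinguished and `c ∈ pℤ_p`: it is monic, and modulo `p` it is
`(T − c̄)^d = T^d`. [cite: Washington1997, §7.1 (distinguished polynomials)] -/
theorem isDistinguishedAt_comp_X_sub_C {f : ℤ_[p][X]}
    (hf : f.IsDistinguishedAt (IsLocalRing.maximalIdeal ℤ_[p])) {c : ℤ_[p]}
    (hc : c ∈ IsLocalRing.maximalIdeal ℤ_[p]) :
    (f.comp (Polynomial.X - Polynomial.C c)).IsDistinguishedAt (IsLocalRing.maximalIdeal ℤ_[p]) := by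
  refine ⟨⟨fun {i} hi => ?_⟩, hf.monic.comp_X_sub_C c⟩
  rw [natDegree_comp_X_sub_C] at hi
  rw [← Ideal.Quotient.eq_zero_iff_mem, ← Polynomial.coeff_map, Polynomial.map_comp, hf.map_eq_X_pow,
    Polynomial.map_sub, Polynomial.map_X, Polynomial.map_C, Ideal.Quotient.eq_zero_iff_mem.mpr hc, map_zero,
    sub_zero, Polynomial.comp_X, Polynomial.coeff_X_pow, if_neg hi.ne]

/-- **`f(T − c)` is irreducible** if `f` is: `f(T − c) = σ_{−c}(f)` for the algebra automorphism
`σ_t : h ↦ h(T + t)` of `ℤ_p[T]`. [cite: Washington1997, §7.1 (distinguished polynomials)] -/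
theorem irreducible_comp_X_sub_C {f : ℤ_[p][X]} (hirr : Irreducible f) (c : ℤ_[p]) :
    Irreducible (f.comp (Polynomial.X - Polynomial.C c)) := by
  rw [show f.comp (Polynomial.X - Polynomial.C c) = Polynomial.algEquivAevalXAddC (-c) f by
    rw [Polynomial.algEquivAevalXAddC_apply, map_neg, ← sub_eq_add_neg, Polynomial.comp_eq_aeval]]
  exact (MulEquiv.irreducible_iff (Polynomial.algEquivAevalXAddC (-c))).mpr hirr

/-- The translate `f(T − c)` of a distinguished irreducible `f` is a prime element of `Λ`.
[cite: Washington1997, §13.2] -/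
theorem prime_coe_comp_X_sub_C {f : ℤ_[p][X]} (hf : f.IsDistinguishedAt (IsLocalRing.maximalIdeal ℤ_[p]))
    (hirr : Irreducible f) {c : ℤ_[p]} (hc : c ∈ IsLocalRing.maximalIdeal ℤ_[p]) :
    Prime ((f.comp (Polynomial.X - Polynomial.C c) : ℤ_[p][X]) : IwasawaAlgebra p) :=
  prime_coe_of_irreducible p (isDistinguishedAt_comp_X_sub_C p hf hc) (irreducible_comp_X_sub_C p hirr c)

/-- The Weierstrass-division isomorphism `ℤ_p[T]/(g) ≃ Λ/(g)` on classes of polynomials.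
[cite: Lang1980, Ch. 5 §2 Thm. 2.1] -/
theorem algEquivQuotient_mk {g : ℤ_[p][X]} (hg : g.IsDistinguishedAt (IsLocalRing.maximalIdeal ℤ_[p]))
    (q : ℤ_[p][X]) : hg.algEquivQuotient (Ideal.Quotient.mk (Ideal.span {g}) q) =
      Ideal.Quotient.mk (Ideal.span {(g : IwasawaAlgebra p)}) (q : IwasawaAlgebra p) := by
  rw [Polynomial.IsDistinguishedAt.algEquivQuotient_apply, Ideal.quotient_map_mkₐ, Ideal.Quotient.mkₐ_eq_mk,
    Polynomial.coeToPowerSeries.algHom_apply, Algebra.algebraMap_self, PowerSeries.map_id, id_eq]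

/-! ### §2 The coefficient ring `Λ ⧸ (f(T − c)) ≅ Λ ⧸ (f)` and transport of counts -/

/-- **The coefficient ring of a translated prime is independent of the translation.** For `f` distinguished and
`c ∈ pℤ_p` there is a `ℤ_p`-algebra isomorphism `Λ ⧸ (f(T − c)) ≃ Λ ⧸ (f)` sending the class of a polynomial
`h` to the class of `h(T + c)` (both sides are `ℤ_p[T]/(·)` by Weierstrass division; `T ↦ T + c` is an
automorphism of `ℤ_p[T]` carrying `(f(T − c))` to `(f)`); no Hensel/Krasner argument, in contrast to the perturbed
primes `(f + p^m)`. [cite: Howard2004HeegnerKolyvagin, proof of Thm. 2.2.10 («Λ/𝔔 ≅ Λ/𝔓 for m ≫ 0»)]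
[cite: Lang1980, Ch. 5 §2 Thm. 2.1] -/
theorem exists_algEquiv_quotient_span_comp_X_sub_C {f : ℤ_[p][X]}
    (hf : f.IsDistinguishedAt (IsLocalRing.maximalIdeal ℤ_[p])) {c : ℤ_[p]}
    (hc : c ∈ IsLocalRing.maximalIdeal ℤ_[p]) :
    ∃ Φ : (IwasawaAlgebra p ⧸
        Ideal.span {((f.comp (Polynomial.X - Polynomial.C c) : ℤ_[p][X]) : IwasawaAlgebra p)}) ≃ₐ[ℤ_[p]]
        (IwasawaAlgebra p ⧸ Ideal.span {(f : IwasawaAlgebra p)}),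
      ∀ h : ℤ_[p][X], Φ (Ideal.Quotient.mk _ (h : IwasawaAlgebra p)) =
        Ideal.Quotient.mk _ ((h.comp (Polynomial.X + Polynomial.C c) : ℤ_[p][X]) : IwasawaAlgebra p) := by
  set Q : ℤ_[p][X] := f.comp (Polynomial.X - Polynomial.C c) with hQdef
  have hQ := isDistinguishedAt_comp_X_sub_C p hf hc
  set σ : ℤ_[p][X] ≃ₐ[ℤ_[p]] ℤ_[p][X] := Polynomial.algEquivAevalXAddC c with hσdef
  have hσ : ∀ h : ℤ_[p][X], σ h = h.comp (Polynomial.X + Polynomial.C c) := fun h => by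
    rw [hσdef, Polynomial.algEquivAevalXAddC_apply, Polynomial.comp_eq_aeval]
  have hσQ : σ Q = f := by
    rw [hσ, hQdef, Polynomial.comp_assoc, Polynomial.sub_comp, Polynomial.X_comp, Polynomial.C_comp,
      add_sub_cancel_right, Polynomial.comp_X]
  have hmap : Ideal.span {f} = (Ideal.span {Q}).map (σ : ℤ_[p][X] →+* ℤ_[p][X]) := by
    rw [Ideal.map_span, Set.image_singleton, RingHom.coe_coe, hσQ]
  let Φ : (IwasawaAlgebra p ⧸ Ideal.span {(Q : IwasawaAlgebra p)}) ≃ₐ[ℤ_[p]]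
      (IwasawaAlgebra p ⧸ Ideal.span {(f : IwasawaAlgebra p)}) :=
    (hQ.algEquivQuotient.symm.trans (Ideal.quotientEquivAlg (Ideal.span {Q}) (Ideal.span {f}) σ hmap)).trans
      hf.algEquivQuotient
  refine ⟨Φ, fun h => ?_⟩
  have e2 : Ideal.quotientEquivAlg (Ideal.span {Q}) (Ideal.span {f}) σ hmap (Ideal.Quotient.mk (Ideal.span {Q}) h) =
      Ideal.Quotient.mk (Ideal.span {f}) (σ h) := rfl
  rw [← algEquivQuotient_mk p hQ]
  change hf.algEquivQuotient (Ideal.quotientEquivAlg (Ideal.span {Q}) (Ideal.span {f}) σ hmap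
    (hQ.algEquivQuotient.symm (hQ.algEquivQuotient (Ideal.Quotient.mk (Ideal.span {Q}) h)))) = _
  rw [AlgEquiv.symm_apply_apply, e2, algEquivQuotient_mk, hσ]

/-- Counting through an isomorphism of quotient rings: if `Φ : Λ/I ≃ Λ/I'` carries `J̄` to `J̄'`, then
`#Λ/(I + J) = #Λ/(I' + J')` (third isomorphism theorem on both sides; private helper). [folklore] -/
private theorem card_quotient_sup_eq_of_ringEquiv {I I' J J' : Ideal (IwasawaAlgebra p)}
    (Φ : (IwasawaAlgebra p ⧸ I) ≃+* (IwasawaAlgebra p ⧸ I'))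
    (hJJ' : J'.map (Ideal.Quotient.mk I') =
      (J.map (Ideal.Quotient.mk I)).map (Φ : (IwasawaAlgebra p ⧸ I) →+* (IwasawaAlgebra p ⧸ I'))) :
    Nat.card (IwasawaAlgebra p ⧸ (I ⊔ J)) = Nat.card (IwasawaAlgebra p ⧸ (I' ⊔ J')) :=
  calc Nat.card (IwasawaAlgebra p ⧸ (I ⊔ J))
      = Nat.card ((IwasawaAlgebra p ⧸ I) ⧸ J.map (Ideal.Quotient.mk I)) :=
        Nat.card_congr (DoubleQuot.quotQuotEquivQuotSup I J).toEquiv.symm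
    _ = Nat.card ((IwasawaAlgebra p ⧸ I') ⧸ J'.map (Ideal.Quotient.mk I')) :=
        Nat.card_congr (Ideal.quotientEquiv (J.map (Ideal.Quotient.mk I)) (J'.map (Ideal.Quotient.mk I')) Φ hJJ').toEquiv
    _ = Nat.card (IwasawaAlgebra p ⧸ (I' ⊔ J')) := Nat.card_congr (DoubleQuot.quotQuotEquivQuotSup I' J').toEquiv

/-- **Transport of counts along the coefficient-ring isomorphism**: `#Λ/(f(T − c), h) = #Λ/(f, h(T + c))` for every
polynomial `h`. [cite: Washington1997, §13.2 (Lemma 13.7)] [cite: MazurRubin2004, §5.3 (proof of Thm. 5.3.10)] -/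
theorem card_quotient_span_comp_sup_span_coe {f : ℤ_[p][X]}
    (hf : f.IsDistinguishedAt (IsLocalRing.maximalIdeal ℤ_[p])) {c : ℤ_[p]}
    (hc : c ∈ IsLocalRing.maximalIdeal ℤ_[p]) (h : ℤ_[p][X]) :
    Nat.card (IwasawaAlgebra p ⧸
      (Ideal.span {((f.comp (Polynomial.X - Polynomial.C c) : ℤ_[p][X]) : IwasawaAlgebra p)} ⊔
        Ideal.span {(h : IwasawaAlgebra p)})) =
    Nat.card (IwasawaAlgebra p ⧸ (Ideal.span {(f : IwasawaAlgebra p)} ⊔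
      Ideal.span {((h.comp (Polynomial.X + Polynomial.C c) : ℤ_[p][X]) : IwasawaAlgebra p)})) := by
  obtain ⟨Φ, hΦ⟩ := exists_algEquiv_quotient_span_comp_X_sub_C p hf hc
  refine card_quotient_sup_eq_of_ringEquiv p Φ.toRingEquiv ?_
  rw [Ideal.map_span, Ideal.map_span, Ideal.map_span, Set.image_singleton, Set.image_singleton, Set.image_singleton]
  congr 2
  exact (hΦ h).symm

/-! ### §3 Ideal lemmas: congruent generators, `p`-adic perturbations, Taylor expansions -/

/-- `I + (a) = I + (b)` when `a ≡ b (mod I)`. [cite: Washington1997, §13.2 (Lemma 13.7: computations in Λ/(f, g))] -/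
theorem sup_span_singleton_eq_of_sub_mem {I : Ideal (IwasawaAlgebra p)} {a b : IwasawaAlgebra p}
    (hab : a - b ∈ I) : I ⊔ Ideal.span {a} = I ⊔ Ideal.span {b} := by
  apply le_antisymm <;> refine sup_le le_sup_left ((Ideal.span_singleton_le_iff_mem _).mpr ?_)
  · rw [show a = (a - b) + b by ring]
    exact Ideal.add_mem _ (Ideal.mem_sup_left hab) (Ideal.mem_sup_right (Ideal.mem_span_singleton_self _))
  · rw [show b = a - (a - b) by ring]
    exact Ideal.sub_mem _ (Ideal.mem_sup_right (Ideal.mem_span_singleton_self _)) (Ideal.mem_sup_left hab)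

/-- `(q) + (aⁿ) = (q) + (bⁿ)` when `a ≡ b (mod q)`. [cite: Washington1997, §13.2 (Lemma 13.7)] -/
theorem span_sup_span_pow_eq_of_sub_mem {q a b : IwasawaAlgebra p} (hab : a - b ∈ Ideal.span {q}) (n : ℕ) :
    Ideal.span {q} ⊔ Ideal.span {a ^ n} = Ideal.span {q} ⊔ Ideal.span {b ^ n} := by
  refine sup_span_singleton_eq_of_sub_mem p ?_
  obtain ⟨k, hk⟩ := sub_dvd_pow_sub_pow a b n
  rw [hk]
  exact Ideal.mul_mem_right _ _ hab

/-- **`(q, h + p^m·r) = (q, h)`** as soon as `p^{m₀} ∈ (q, h)` and `m > m₀`: writing `p^{m₀} = αq + βh`,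
`h + p^m r = h(1 + p^{m−m₀} r β) + p^{m−m₀} r α q` with `1 + p^{m−m₀} r β ∈ Λˣ`.
[cite: Washington1997, §13.2 (Lemma 13.7)] [cite: Howard2004HeegnerKolyvagin, proof of Thm. 2.2.10] -/
theorem span_sup_span_add_mul_C_pow_eq_of_C_pow_mem {q h : IwasawaAlgebra p} (r : IwasawaAlgebra p) {m₀ m : ℕ}
    (h0 : PowerSeries.C ((p : ℤ_[p]) ^ m₀) ∈ Ideal.span {q} ⊔ Ideal.span {h}) (hm : m₀ < m) :
    Ideal.span {q} ⊔ Ideal.span {h + PowerSeries.C ((p : ℤ_[p]) ^ m) * r} = Ideal.span {q} ⊔ Ideal.span {h} := by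
  have hcc : PowerSeries.C ((p : ℤ_[p]) ^ m) =
      PowerSeries.C ((p : ℤ_[p]) ^ m₀) * PowerSeries.C ((p : ℤ_[p]) ^ (m - m₀)) := by
    rw [← map_mul, ← pow_add, Nat.add_sub_cancel' hm.le]
  set c₀ : IwasawaAlgebra p := PowerSeries.C ((p : ℤ_[p]) ^ m₀) with hc₀
  set t : IwasawaAlgebra p := PowerSeries.C ((p : ℤ_[p]) ^ (m - m₀)) with ht
  rw [hcc]
  apply le_antisymm
  · refine sup_le le_sup_left ((Ideal.span_singleton_le_iff_mem _).mpr ?_)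
    refine Ideal.add_mem _ (Ideal.mem_sup_right (Ideal.mem_span_singleton_self _)) ?_
    rw [mul_assoc]
    exact Ideal.mul_mem_right _ _ h0
  · refine sup_le le_sup_left ((Ideal.span_singleton_le_iff_mem _).mpr ?_)
    obtain ⟨α, y, hy, hαy⟩ := Ideal.mem_span_singleton_sup.mp h0
    obtain ⟨β, rfl⟩ := Ideal.mem_span_singleton'.mp hy
    obtain ⟨v, hv'⟩ := isUnit_one_add_mul_C_pow p (r * β) (j := m - m₀) (by omega)
    -- `h · v ∈ (q, h + c₀ t r)`
    have hmem : h * (1 + r * β * t) ∈ Ideal.span {q} ⊔ Ideal.span {h + c₀ * t * r} := by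
      have h1 : h * (1 + r * β * t) = (h + c₀ * t * r) - t * r * α * q := by
        linear_combination t * r * hαy
      rw [h1]
      exact Ideal.sub_mem _ (Ideal.mem_sup_right (Ideal.mem_span_singleton_self _))
        (Ideal.mem_sup_left (Ideal.mul_mem_left _ _ (Ideal.mem_span_singleton_self _)))
    have hvt : (1 + r * β * t) = (v : IwasawaAlgebra p) := by rw [hv']
    have h2 := Ideal.mul_mem_right ((v⁻¹ : (IwasawaAlgebra p)ˣ) : IwasawaAlgebra p) _ hmem
    rwa [hvt, Units.mul_inv_cancel_right] at h2

/-- A nonzero polynomial of degree `< deg f` is not divisible in `Λ` by the distinguished polynomial `f`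
(`Λ/(f) ≅ ℤ_p[T]/(f)`, where degrees forbid it). [cite: Lang1980, Ch. 5 §2 Thm. 2.1] -/
theorem not_coe_dvd_coe_of_natDegree_lt {f : ℤ_[p][X]}
    (hf : f.IsDistinguishedAt (IsLocalRing.maximalIdeal ℤ_[p])) {h : ℤ_[p][X]} (h0 : h ≠ 0)
    (hdeg : h.natDegree < f.natDegree) : ¬ (f : IwasawaAlgebra p) ∣ (h : IwasawaAlgebra p) := by
  intro hdvd
  have h1 : hf.algEquivQuotient (Ideal.Quotient.mk (Ideal.span {f}) h) = 0 := by
    rw [algEquivQuotient_mk, Ideal.Quotient.eq_zero_iff_mem, Ideal.mem_span_singleton]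
    exact hdvd
  rw [EmbeddingLike.map_eq_zero_iff, Ideal.Quotient.eq_zero_iff_mem, Ideal.mem_span_singleton] at h1
  exact absurd (Polynomial.natDegree_le_of_dvd h1 h0) (not_le.mpr hdeg)

/-- `f ∤ f′` in `Λ` for a distinguished `f` of positive degree (`char ℤ_p = 0`). [cite: Washington1997, Prop. 7.2] -/
theorem not_coe_dvd_coe_derivative {f : ℤ_[p][X]}
    (hf : f.IsDistinguishedAt (IsLocalRing.maximalIdeal ℤ_[p])) (hd : 0 < f.natDegree) :
    ¬ (f : IwasawaAlgebra p) ∣ ((Polynomial.derivative f : ℤ_[p][X]) : IwasawaAlgebra p) :=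
  not_coe_dvd_coe_of_natDegree_lt p hf
    (fun h0 => hd.ne' (Polynomial.derivative_eq_zero.mp h0))
    (Polynomial.natDegree_derivative_lt hd.ne')

/-- Taylor to first order: `h(T + c) = h(T) + c · r` for some polynomial `r`.
[cite: MazurRubin2004, §5.3 (proof of Thm. 5.3.10)] -/
theorem exists_comp_X_add_C_eq_add_C_mul (h : ℤ_[p][X]) (c : ℤ_[p]) :
    ∃ r : ℤ_[p][X], h.comp (Polynomial.X + Polynomial.C c) = h + Polynomial.C c * r := by
  obtain ⟨r, hr⟩ := Polynomial.sub_dvd_eval_sub (Polynomial.X + Polynomial.C c) Polynomial.X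
    (h.map Polynomial.C)
  rw [add_sub_cancel_left, Polynomial.eval_map, Polynomial.eval_map, Polynomial.eval₂_C_X] at hr
  exact ⟨r, by rw [← hr, Polynomial.comp]; ring⟩

/-- Taylor to second order: `f(T + c) = f(T) + f′(T)·c + k·c²` for some polynomial `k`.
[cite: Lang1980, Ch. 5 §2 (formal Taylor expansion)] -/
theorem exists_comp_X_add_C_eq_add_derivative_mul (f : ℤ_[p][X]) (c : ℤ_[p]) :
    ∃ k : ℤ_[p][X], f.comp (Polynomial.X + Polynomial.C c) =
      f + Polynomial.derivative f * Polynomial.C c + k * Polynomial.C c ^ 2 := by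
  obtain ⟨k, hk⟩ := Polynomial.exists_mul_sq_add_linear_part_eq_eval_add (f.map Polynomial.C) Polynomial.X
    (Polynomial.C c)
  rw [Polynomial.derivative_map, Polynomial.eval_map, Polynomial.eval_map, Polynomial.eval_map,
    Polynomial.eval₂_C_X, Polynomial.eval₂_C_X] at hk
  exact ⟨k, by rw [Polynomial.comp, ← hk]; ring⟩

/-! ### §4 Counting `Λ ⧸ (𝔮_m, ·)` at the translated primes `𝔮_m = (f(T − p^m))` -/

/-- `#(Λ ⧸ (𝔮_m, p^μ)) = p^{μ deg f}` (`f(T − p^m)` is distinguished of degree `deg f`, `m ≥ 1`).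
[cite: Washington1997, §13.2 (Prop. 13.8)] -/
theorem card_quotient_span_comp_sup_span_C_pow {f : ℤ_[p][X]}
    (hf : f.IsDistinguishedAt (IsLocalRing.maximalIdeal ℤ_[p])) {m : ℕ} (hm : 1 ≤ m) (μ : ℕ) :
    Nat.card (IwasawaAlgebra p ⧸
      (Ideal.span {((f.comp (Polynomial.X - Polynomial.C ((p : ℤ_[p]) ^ m)) : ℤ_[p][X]) : IwasawaAlgebra p)} ⊔
        Ideal.span {PowerSeries.C ((p : ℤ_[p]) ^ μ)})) = p ^ (μ * f.natDegree) := by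
  rw [card_quotient_span_coe_sup_span_C_pow p (isDistinguishedAt_comp_X_sub_C p hf (pow_p_mem_maximalIdeal p hm))
    μ, natDegree_comp_X_sub_C]

/-- **The cyclic piece `Λ/(gⁿ)` modulo `𝔮_m = (f(T − p^m))`**, `f, g` distinguished irreducible: there are `c ≥ 1`,
`m₀` with `#((Λ/(gⁿ)) ⧸ 𝔮_m) = c · p^{m · deg f · e}` for all `m > m₀`, where `e = n` if `f ∣ g` (`#Λ/(𝔮_m, fⁿ) =
#Λ/(f, f(T + p^m)ⁿ)`, `f(T + p^m) ≡ p^m (f′ + p^m k) (mod f)`, `c = #Λ/(f, f′ⁿ)`) and `e = 0` otherwise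
(`#Λ/(𝔮_m, gⁿ) = #Λ/(f, gⁿ + p^m r) = #Λ/(f, gⁿ)` eventually). [cite: Howard2004HeegnerKolyvagin, proof of Thm. 2.2.10]
[cite: Washington1997, §13.2 (Lemma 13.7, Thm. 13.12)] -/
theorem exists_card_quotient_coe_pow_quotSMulTop_comp {f : ℤ_[p][X]}
    (hf : f.IsDistinguishedAt (IsLocalRing.maximalIdeal ℤ_[p])) (hirr : Irreducible f)
    {g : ℤ_[p][X]} (hg : g.IsDistinguishedAt (IsLocalRing.maximalIdeal ℤ_[p])) (hgirr : Irreducible g) (n : ℕ) :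
    ∃ c m₀ : ℕ, 0 < c ∧ ∀ m : ℕ, m₀ < m →
      Nat.card ((IwasawaAlgebra p ⧸ Ideal.span {(g : IwasawaAlgebra p) ^ n}) ⧸
        (Ideal.span {((f.comp (Polynomial.X - Polynomial.C ((p : ℤ_[p]) ^ m)) : ℤ_[p][X]) : IwasawaAlgebra p)} • ⊤ :
          Submodule (IwasawaAlgebra p) (IwasawaAlgebra p ⧸ Ideal.span {(g : IwasawaAlgebra p) ^ n}))) =
      c * p ^ (m * (f.natDegree * (if (f : IwasawaAlgebra p) ∣ (g : IwasawaAlgebra p) then n else 0))) := by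
  have hd := natDegree_pos_of_irreducible p hf hirr
  have hfprime := prime_coe_of_irreducible p hf hirr
  by_cases hdvd : (f : IwasawaAlgebra p) ∣ (g : IwasawaAlgebra p)
  · -- `(gⁿ) = (fⁿ)`; modulo `f`, `f(T + p^m)ⁿ ≡ p^{mn} (f′ + p^m k)ⁿ`
    have hassoc : Associated (f : IwasawaAlgebra p) (g : IwasawaAlgebra p) :=
      hfprime.irreducible.associated_of_dvd (prime_coe_of_irreducible p hg hgirr).irreducible hdvd
    have hspan : Ideal.span {(g : IwasawaAlgebra p) ^ n} = Ideal.span {(f : IwasawaAlgebra p) ^ n} :=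
      Ideal.span_singleton_eq_span_singleton.mpr (hassoc.symm.pow_pow)
    set f' : IwasawaAlgebra p := ((Polynomial.derivative f : ℤ_[p][X]) : IwasawaAlgebra p) with hf'def
    have hrel : IsRelPrime (f' ^ n) (f : IwasawaAlgebra p) :=
      IsRelPrime.pow_left (hfprime.irreducible.isRelPrime_iff_not_dvd.mpr (not_coe_dvd_coe_derivative p hf hd)).symm
    haveI hfin : Finite (IwasawaAlgebra p ⧸ (Ideal.span {(f : IwasawaAlgebra p)} ⊔ Ideal.span {f' ^ n})) :=
      finite_quotient_span_coe_sup_span p hf hrel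
    obtain ⟨m₀, hm₀⟩ := exists_C_pow_mem_of_finite p (Ideal.span {(f : IwasawaAlgebra p)} ⊔ Ideal.span {f' ^ n})
    refine ⟨Nat.card (IwasawaAlgebra p ⧸ (Ideal.span {(f : IwasawaAlgebra p)} ⊔ Ideal.span {f' ^ n})), m₀,
      Nat.card_pos, fun m hm => ?_⟩
    have hm1 : 1 ≤ m := by omega
    set cm : ℤ_[p] := (p : ℤ_[p]) ^ m with hcm
    rw [if_pos hdvd, card_quotient_quotSMulTop, hspan, sup_comm, ← Polynomial.coe_pow,
      card_quotient_span_comp_sup_span_coe p hf (pow_p_mem_maximalIdeal p hm1), Polynomial.pow_comp,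
      Polynomial.coe_pow]
    obtain ⟨k, hk⟩ := exists_comp_X_add_C_eq_add_derivative_mul p f cm
    set w : IwasawaAlgebra p := f' + (k : IwasawaAlgebra p) * PowerSeries.C cm with hw
    have hcong : ((f.comp (Polynomial.X + Polynomial.C cm) : ℤ_[p][X]) : IwasawaAlgebra p) -
        PowerSeries.C cm * w ∈ Ideal.span {(f : IwasawaAlgebra p)} := by
      rw [hk, Polynomial.coe_add, Polynomial.coe_add, Polynomial.coe_mul, Polynomial.coe_mul, Polynomial.coe_pow,
        Polynomial.coe_C, hw]
      exact Ideal.mem_span_singleton'.mpr ⟨1, by ring⟩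
    -- `wⁿ = f′ⁿ + p^m s`, so `(f, wⁿ) = (f, f′ⁿ)` for `m > m₀`; in particular `f ∤ wⁿ`
    obtain ⟨s, hs⟩ : ∃ s : IwasawaAlgebra p, w ^ n = f' ^ n + PowerSeries.C cm * s := by
      obtain ⟨s, hs⟩ := sub_dvd_pow_sub_pow w f' n
      refine ⟨(k : IwasawaAlgebra p) * s, ?_⟩
      rw [show w - f' = (k : IwasawaAlgebra p) * PowerSeries.C cm by rw [hw]; ring] at hs
      linear_combination hs
    have heq : Ideal.span {(f : IwasawaAlgebra p)} ⊔ Ideal.span {w ^ n} =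
        Ideal.span {(f : IwasawaAlgebra p)} ⊔ Ideal.span {f' ^ n} := by
      rw [hs, hcm, span_sup_span_add_mul_C_pow_eq_of_C_pow_mem p s hm₀ hm]
    have hrelw : IsRelPrime (w ^ n) (f : IwasawaAlgebra p) := by
      refine (hfprime.irreducible.isRelPrime_iff_not_dvd.mpr fun hfw => ?_).symm
      have h2 : f' ^ n ∈ Ideal.span {(f : IwasawaAlgebra p)} ⊔ Ideal.span {w ^ n} :=
        heq ▸ Ideal.mem_sup_right (Ideal.mem_span_singleton_self _)
      rw [sup_eq_left.mpr ((Ideal.span_singleton_le_iff_mem _).mpr (Ideal.mem_span_singleton.mpr hfw)),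
        Ideal.mem_span_singleton] at h2
      exact not_coe_dvd_coe_derivative p hf hd (hfprime.dvd_of_dvd_pow h2)
    rw [span_sup_span_pow_eq_of_sub_mem p hcong n, mul_pow, ← map_pow,
      card_quotient_span_sup_span_mul p (PowerSeries.C (cm ^ n)) hrelw, heq, hcm, ← pow_mul,
      card_quotient_span_coe_sup_span_C_pow p hf (m * n)]
    ring
  · -- `gⁿ` is prime to `f`: `(𝔮_m, gⁿ) ↦ (f, gⁿ(T + p^m)) = (f, gⁿ + p^m r) = (f, gⁿ)` eventually
    have hrel : IsRelPrime ((g : IwasawaAlgebra p) ^ n) (f : IwasawaAlgebra p) :=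
      IsRelPrime.pow_left (hfprime.irreducible.isRelPrime_iff_not_dvd.mpr hdvd).symm
    haveI hfin : Finite (IwasawaAlgebra p ⧸ (Ideal.span {(f : IwasawaAlgebra p)} ⊔
        Ideal.span {(g : IwasawaAlgebra p) ^ n})) := finite_quotient_span_coe_sup_span p hf hrel
    obtain ⟨m₀, hm₀⟩ := exists_C_pow_mem_of_finite p
      (Ideal.span {(f : IwasawaAlgebra p)} ⊔ Ideal.span {(g : IwasawaAlgebra p) ^ n})
    refine ⟨Nat.card (IwasawaAlgebra p ⧸ (Ideal.span {(f : IwasawaAlgebra p)} ⊔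
        Ideal.span {(g : IwasawaAlgebra p) ^ n})), m₀, Nat.card_pos, fun m hm => ?_⟩
    have hm1 : 1 ≤ m := by omega
    obtain ⟨r, hr⟩ := exists_comp_X_add_C_eq_add_C_mul p (g ^ n) ((p : ℤ_[p]) ^ m)
    rw [if_neg hdvd, mul_zero, mul_zero, pow_zero, mul_one, card_quotient_quotSMulTop, sup_comm, ← Polynomial.coe_pow,
      card_quotient_span_comp_sup_span_coe p hf (pow_p_mem_maximalIdeal p hm1), hr, Polynomial.coe_add,
      Polynomial.coe_mul, Polynomial.coe_C, Polynomial.coe_pow,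
      span_sup_span_add_mul_C_pow_eq_of_C_pow_mem p (r : IwasawaAlgebra p) hm₀ hm]

/-- **`#(E(μs, fs) ⧸ 𝔮_m) = C · p^{m · deg f · e(E)}` for all large `m`** at the translated primes `𝔮_m = (f(T − p^m))`,
`e(E) = Σ_{f ∣ gⱼ} nⱼ` the multiplicity of `(f)` in `char E`, `C ≥ 1` independent of `m` (piece by piece).
[cite: Howard2004HeegnerKolyvagin, proof of Thm. 2.2.10] [cite: Washington1997, §13.2 (Thm. 13.12)] -/
theorem exists_card_elementaryModule_quotSMulTop_comp {f : ℤ_[p][X]}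
    (hf : f.IsDistinguishedAt (IsLocalRing.maximalIdeal ℤ_[p])) (hirr : Irreducible f)
    {μs : List ℕ} {fs : List (ℤ_[p][X] × ℕ)}
    (hfs : ∀ g ∈ fs, g.1.IsDistinguishedAt (IsLocalRing.maximalIdeal ℤ_[p]) ∧ Irreducible g.1) :
    ∃ C m₁ : ℕ, 0 < C ∧ ∀ m : ℕ, m₁ ≤ m →
      Nat.card ((elementaryModule p μs fs) ⧸
        (Ideal.span {((f.comp (Polynomial.X - Polynomial.C ((p : ℤ_[p]) ^ m)) : ℤ_[p][X]) : IwasawaAlgebra p)} • ⊤ :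
          Submodule (IwasawaAlgebra p) (elementaryModule p μs fs))) =
      C * p ^ (m * (f.natDegree *
        (fs.map fun g => if (f : IwasawaAlgebra p) ∣ (g.1 : IwasawaAlgebra p) then g.2 else 0).sum)) := by
  have hp : p.Prime := Fact.out
  have hpiece := fun j : Fin fs.length =>
    exists_card_quotient_coe_pow_quotSMulTop_comp p hf hirr (hfs _ (List.get_mem fs j)).1
      (hfs _ (List.get_mem fs j)).2 (fs.get j).2
  choose c m₀ hc hcm using hpiece
  refine ⟨p ^ (μs.sum * f.natDegree) * ∏ j, c j, (∑ j, m₀ j) + 1,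
    Nat.mul_pos (pow_pos hp.pos _) (Finset.prod_pos fun j _ => hc j), fun m hm => ?_⟩
  have hm1 : 1 ≤ m := by omega
  have hmj : ∀ j, m₀ j < m := fun j =>
    lt_of_le_of_lt (Finset.single_le_sum (f := m₀) (fun _ _ => Nat.zero_le _) (Finset.mem_univ j)) (by omega)
  set q : IwasawaAlgebra p :=
    ((f.comp (Polynomial.X - Polynomial.C ((p : ℤ_[p]) ^ m)) : ℤ_[p][X]) : IwasawaAlgebra p) with hqdef
  have e : elementaryModule p μs fs ≃ₗ[IwasawaAlgebra p]
      ((⨁ i : Fin μs.length,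
          IwasawaAlgebra p ⧸ Ideal.span {PowerSeries.C ((p : ℤ_[p]) ^ μs.get i)}) ×
        ⨁ j : Fin fs.length,
          IwasawaAlgebra p ⧸ Ideal.span {((fs.get j).1 : IwasawaAlgebra p) ^ (fs.get j).2}) :=
    LinearEquiv.refl _ _
  rw [Module.card_quotSMulTop_eq_of_linearEquiv
      (M' := ((⨁ i : Fin μs.length,
          IwasawaAlgebra p ⧸ Ideal.span {PowerSeries.C ((p : ℤ_[p]) ^ μs.get i)}) ×
        ⨁ j : Fin fs.length,
          IwasawaAlgebra p ⧸ Ideal.span {((fs.get j).1 : IwasawaAlgebra p) ^ (fs.get j).2})) _ e,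
    Module.card_prod_quotSMulTop
      (⨁ i : Fin μs.length, IwasawaAlgebra p ⧸ Ideal.span {PowerSeries.C ((p : ℤ_[p]) ^ μs.get i)})
      (⨁ j : Fin fs.length, IwasawaAlgebra p ⧸ Ideal.span {((fs.get j).1 : IwasawaAlgebra p) ^ (fs.get j).2})
      (Ideal.span {q}),
    Module.card_directSum_quotSMulTop, Module.card_directSum_quotSMulTop]
  -- `p`-primary pieces: the constant `p^{deg f · Σ μᵢ}`
  rw [Finset.prod_congr rfl fun i _ => by
      rw [card_quotient_quotSMulTop, sup_comm, hqdef, card_quotient_span_comp_sup_span_C_pow p hf hm1],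
    Finset.prod_pow_eq_pow_sum]
  -- distinguished pieces
  rw [Finset.prod_congr rfl fun j _ => hcm j m (hmj j), Finset.prod_mul_distrib, Finset.prod_pow_eq_pow_sum,
    ← Finset.mul_sum, ← Finset.mul_sum]
  have hsum1 : ∑ i : Fin μs.length, μs.get i * f.natDegree = μs.sum * f.natDegree := by
    rw [← Finset.sum_mul]; simp [Fin.sum_univ_getElem]
  have hsum2 : ∑ j : Fin fs.length,
      (if (f : IwasawaAlgebra p) ∣ ((fs.get j).1 : IwasawaAlgebra p) then (fs.get j).2 else 0) =
      (fs.map fun g => if (f : IwasawaAlgebra p) ∣ (g.1 : IwasawaAlgebra p) then g.2 else 0).sum := by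
    simp_rw [List.get_eq_getElem]
    exact Fin.sum_univ_fun_getElem fs
      (fun g : ℤ_[p][X] × ℕ => if (f : IwasawaAlgebra p) ∣ (g.1 : IwasawaAlgebra p) then g.2 else 0)
  rw [hsum1, hsum2]
  ring

end IwasawaAlgebra

end Literature.NumberTheory.EllipticCurves

end
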